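import Summits.Ventures.HSemireg.FormulaNUniformLaw
import Summits.Ventures.HSemireg.Mod4SignLawParity
import Summits.Ventures.HSemireg.WedgePairShear
import Literature.AlgebraicGeometry.HodgeTheory.AbelianVarietyHodgeNumbers

/-!
# Venture HSemireg — the `n = 4` (g = 8) Ext-WINDOW ARITHMETIC: (S3)'s PINCH half «at n = 4 no secant-type object is
# G-semiregular at all — the n = 4 clause of (S3) carries (H3)» (NOGO-n4), LEMMA C of family B, and the COUNT BARRIER 28

HONEST FRAMING. Part of the Lean index of the computation cell `pub-hsemireg` (seat p9 gen 2, Sunday typer § `g = 8` = Weil-type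
abelian EIGHTFOLDS, `n = 4`).  FINITE-DIMENSIONAL LINEAR ALGEBRA over a field and INTEGER ARITHMETIC ONLY, plus one dimension
count read off the tree's Hodge numbers of a complex abelian variety: no sheaf, no `Ext` group, no group action, no Mukai pairing
and no semiregularity map is constructed; every geometric input is a HYPOTHESIS BY VALUE; the dictionary is QUOTED, not asserted.
Nothing here says that HC / HC_CM / HC_AV holds; nothing here is a new case of anything; no Literature fact is declared.

TEXTS OF RECORD. (1) general-structure/STRUCTURE.md v1.0-SIGNED `9b196a05977dd067` §2 l.177–178 (cited by hash in VERDICT-G6.md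
v1.0 `1651dcc7322662a2`): «(S3) [PROVED given ∫bⁿ > 0, th-7 Σ6; n = 4 case = s0-3 Q824-NO / SQUEEZE-n4 ×2] MOD-4 PARITY LAW:
G-equivariant (G ⊂ translations) secant objects with the Lemma profile exist on abelian n-folds only for n ≢ 0 (mod 4); at n = 4
no secant-type object is G-semiregular at all. … HOLDS as a derivation under three NAMED hypotheses: (H1) ∫bⁿ > 0 (argued from
polarisability; fine for principal b ∝ Θ), (H2) G ⊂ translations acts freely (automatic on an abelian variety ⇒ χ^G = χ/∣G∣),
(H3) for the n = 4 pinch e₀^G ≤ 2 (automatic for F simple), e₁^G ≥ 8, e₂^G = 12 — so «at n = 4 none is G-semiregular at all»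
holds exactly for objects satisfying (H3); a non-simple G-invariant object with e₀^G ≥ 3 is outside the pinch. … PRECISION
ADOPTED v0.20: the n = 4 clause of (S3) carries (H3).»; §1 C12 «… with Σ5 no G-semiregular secant object at all (NOGO-n4)»;
th-7 FORMULA-N-th7.md (Σ5) «τ_k injective on (Ext^k)^G ⟺ ev_{n−k}: HT^{n−k}(X) ↠ (Ext^{n−k})^G … n = 4 (e₂^G = r₂ = 12 forced:
the PINCH)», §D «χ^G(F,F) = (v,v)_χ/∣G∣ … χ^G = 2e₀^G − 2e₁^G + 12 ≤ 0 for e₀^G ≤ 2, e₁^G ≥ 8».  IN THE TREE ALREADY: `FormulaNUniformLaw.lean` (p10) types (S3)'s FIRST clause uniformly in `n` (`ParityDatum`,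
`parityDatum_false_of_four_dvd`); `Mod4SignLawParity.lean` (s4-prove-3, S4 lane (ii)) types the `n = 4` clause as SCALAR
ARITHMETIC with (H1)–(H3) as visible binders and the pinch value `12` written into `χ^G` (`Mod4Sign.pinch_n4_euler_nonpos`,
`Mod4Sign.no_G_semiregular_secant_n4`, with the sign of `(v,v)_χ` from `chiSelfEven`).  THIS FILE ADDS the linear algebra that
PRODUCES those binders — the pinch value `e₂^G = 12` and the bound `e₁^G ≥ 8` DERIVED from `G`-semiregularity, the (Σ5) duality,
the bridge and the tree's THEOREM T — plus the COUNT BARRIER `28` on the carrier, LEMMA C of family B, and sharpness / non-vacuity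
records.  (2) The g = 8 census (`CensusG8Table.lean`) family-B structure rows B19-19 «LEMMA C (on the
abelian FOURFOLD E⁴: e₂ = χ − 2e₀ + 2e₁ by Serre duality; χ(F,F) = 8d(d·rk² + β²) > 0 …) … so e₁ ≥ 8 and for SIMPLE factors
8d(d·rk² + β²) ≤ 30 − 2e₁ ≤ 14» and B19-24 THEOREM (B-XXII) «e₂(G_i) ≥ χ + 14 = 46 ∕ 110 > 28 = dim ⊕_q H^{q+2}(Ω^q) ⇒ σ not
injective» use the same fourfold arithmetic and the same count `28`.
SETTING OF RECORD (paper, th-7 Def. A.2 / §D; NOT constructed): `X` an abelian FOURFOLD, `G ⊂ X` a finite group of translations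
(possibly trivial), `F` a (`G`-equivariant) object on `X`; `e_k := dim Ext^k(F,F)^G`; `ev_k : HT^k(X) → Ext^k(F,F)^G`,
`τ_k : Ext^k(F,F)^G → ⊕_q H^{q+k}(X, Ω^q_X)` (Buchweitz–Flenner); BRIDGE `τ_k ∘ ev_k = (· ⌟ ch F)` ([BuchweitzFlenner2008HH]
Thm 6.4.2 on paper; STRUCTURE D4); «(`G`-)semiregular» = `τ₂` injective.  Such an `F` with `ch F` a transversal `K`-secant
class, transported to the Weil-type EIGHTFOLD `X × X̂`, is what a YES at `g = 8` by Markman's method would need; the `g = 8`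
census of record has 0 candidates (`CensusG8Verdict.outcome_g8`).

CONTENT (all PROVED, 0 sorry; namespace `Summit.Ventures.HSemireg.FormulaN.PinchN4`; details in the decl docstrings):
§1 (Σ5) THE PINCH, abstract — `finrank_eq_of_pinch` (`ev` onto ∧ `τ` injective ∧ `τ ∘ ev = c` ⇒ `dim E = rank c`),
`injective_iff_surjective_of_transpose` («`τ₂` injective ⟺ `ev₂` onto» from Serre-TRANSPOSE DATA BY VALUE, via Mathlib's
`LinearMap.dualMap_injective_iff`), `rank_le_finrank` (`rank c ≤ dim E`: (H3)'s `e₁^G ≥ 8` is automatic given the bridge).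
§2 THE CLASS SIDE AT `n = 4` (tree theorems) — ranks `8`, `12` of `θ ↦ θ ∧ v` on `HT¹`, `HT²` of the wedge model of a fourfold
for a transversal `K`-secant class (`secantRank_one_four`, `secantRank_two_four`: th-7's THEOREM T at `n = 4`).  §3 THE COUNT
BARRIER ON THE CARRIER — for a complex abelian FOURFOLD `A` the Hodge pieces `H^{0,2} ⊕ H^{1,3} ⊕ H^{2,4}` of `H^•(A(ℂ); ℂ)`
(= `⊕_q H^{q+2}(A, Ω^q)` by Dolbeault, [Lange 2023, Thm 1.1.21 (a)]) have total dimension `6 + 16 + 6 = 28`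
(`finrank_dolbeaultTargetTwo`, from `HodgeModel.finrank_typePiece_eq_choose_mul_choose`) ⇒ `finrank_le_finrank_ker_add_28`.
§4 THE WINDOW ARITHMETIC, by value — `FourfoldExtProfile` (LEMMA C `chi_eq`; (B-XXII) `chi_add_le_e2`; B19-19 (g)
`chi_le_of_e2_le`; `lt_e2_of_le_chi`; with §3 `not_injective_of_profile` on the carrier); `SecantDatumN4` extends it by `∣G∣`,
`(v,v)_χ`, (H1) at `n = 4` (`0 < (v,v)_χ`, sign `(−1)^{n/2} = +1` GIVEN `∫_X b⁴ > 0`), (H2)+HRR (`(v,v)_χ = ∣G∣·χ^G`):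
`false_of_H3` ((H1) ∧ (H2) ∧ (H3) ⇒ `False`), SHARP FORM `false_of_le` (`2e₀ + e₂ ≤ 2e₁` suffices), `thirteen_le_e2`,
`toParityDatum` / `false_of_lemmaProfile` (the Lemma profile `(1,8,12,8,1)` satisfies (H3) and yields p10's `ParityDatum 4` —
the two clauses agree), `outsidePinch` (a CONSISTENT datum with `e₀ = 3`: STRUCTURE's own caveat — (H3) is load-bearing,
«STRUCTURAL-NO NOT CLAIMED»; also the non-vacuity of the by-value laws).  §5 NOGO-n4 COMPOSED — `not_injective_tau_two`:
bridges of ranks `8`/`12` + (Σ5) duality + simplicity `e₀ ≤ 2` + (H1)/(H2) by value ⇒ **`τ₂` is NOT injective**;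
`not_injective_tau_two_model`: the same with the class side instantiated by the tree's wedge maps (no rank hypothesis left).
NOT typed (honest list): HRR / the Mukai-pairing computations `(v,v)_χ = 2∣xc∣²(−4d)²∫b⁴/4!`, `χ(F,F) = 8d(d·rk² + β²)` (tree,
exterior-algebra form: `SecantParityPairing`; sign input `SecantParityPositivity` / `Mod4SignLaw`); Serre duality and the
`HT`-module structure of `Ext` (they enter as the transpose data / the implication `duality`); the bridge (D4); `e₀ = 1` for
simple `F`; the «8 universal classes» bound `e₁ ≥ 8` for general factors.
-/

open Module LinearMap Function

namespace Summit.Ventures.HSemireg.FormulaN.PinchN4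

/-! ## §1. (Σ5) the PINCH — abstract linear algebra -/
section Pinch
variable {K : Type*} [Field K]
variable {HT E T : Type*} [AddCommGroup HT] [Module K HT] [AddCommGroup E] [Module K E]
  [AddCommGroup T] [Module K T]

/-- **(Σ5) THE PINCH, abstract form, with the bridge**: if `ev : HT → E` is onto, `τ : E → T` is injective, `τ ∘ ev = c` (the
class-side map `θ ↦ θ ⌟ v`, [BF08] Thm 6.4.2 on paper) and `rank c = R`, then `dim E = R` (th-7 FORMULA-N (Σ5): with
`E = (Ext²)^G` on a fourfold, `τ₂` injective forces `ev₂` onto by duality, and then `e₂^G` IS the class-side rank `r₂(4) = 12` —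
(H3)'s third entry). -/
theorem finrank_eq_of_pinch [FiniteDimensional K E] (ev : HT →ₗ[K] E) (τ : E →ₗ[K] T) (c : HT →ₗ[K] T)
    (bridge : τ ∘ₗ ev = c) {R : ℕ} (hc : finrank K (range c) = R) (hev : Surjective ev) (hτ : Injective τ) :
    finrank K E = R := by
  rw [← hc, ← bridge, LinearMap.range_comp, LinearMap.range_eq_top.mpr hev, Submodule.map_top,
    LinearMap.finrank_range_of_inj hτ]

/-- **(BF) lower bound in any degree**: with the bridge, `rank c ≤ dim E` (at `n = 4`, degree 1: `e₁^G ≥ r₁(4) = 8` —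
(H3)'s second entry is AUTOMATIC given the degree-1 bridge). -/
theorem rank_le_finrank [FiniteDimensional K E] (ev : HT →ₗ[K] E) (τ : E →ₗ[K] T) (c : HT →ₗ[K] T)
    (bridge : τ ∘ₗ ev = c) {R : ℕ} (hc : finrank K (range c) = R) : R ≤ finrank K E := by
  rw [← hc, ← bridge]
  exact Squeeze.finrank_range_comp_le_mid ev τ

/-- **(Σ5) DUALITY at the self-dual degree, from transpose data BY VALUE**: if linear isomorphisms `dE : E ≃ E^*` and
`dT : T ≃ HT^*` intertwine `τ` with the transpose of `ev` (`dT ∘ τ = ev^T ∘ dE`; on paper: Serre duality pairs `(Ext²)^G` with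
itself and `⊕_q H^{q+2}(Ω^q)` with `HT²` on a FOURFOLD, and `⟨τ₂ α, θ⟩ = ⟨α, ev₂ θ⟩` by `HT`-linearity of `σ`), then
`τ` is injective iff `ev` is onto (Mathlib `LinearMap.dualMap_injective_iff`). -/
theorem injective_iff_surjective_of_transpose (ev : HT →ₗ[K] E) (τ : E →ₗ[K] T)
    (dE : E ≃ₗ[K] Module.Dual K E) (dT : T ≃ₗ[K] Module.Dual K HT)
    (adj : dT.toLinearMap ∘ₗ τ = ev.dualMap ∘ₗ dE.toLinearMap) :
    Injective τ ↔ Surjective ev := by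
  rw [← LinearMap.dualMap_injective_iff, ← dT.injective.of_comp_iff τ, ← Injective.of_comp_iff' ev.dualMap dE.bijective]
  change Injective (dT.toLinearMap ∘ₗ τ) ↔ Injective (ev.dualMap ∘ₗ dE.toLinearMap)
  rw [adj]

end Pinch

/-! ## §2. The class side at `n = 4` — tree theorems (th-7's THEOREM T on the wedge model of a fourfold) -/
section ClassSide
/-- `r_k(4) = [t^k] P_4(t) = (1, 8, 12, 8, 1)`: the rank profile of a transversal `K`-secant class on a FOURFOLD
(STRUCTURE C6 «(1, 2n, n(n−1))» at `n = 4`; `FormulaNUniformKernel.instances_factor`, third clause). -/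
theorem transversePairRank_four : (List.range 5).map (transversePairRank 4) = [1, 8, 12, 8, 1] := by decide

variable (K : Type*) [Field K]

/-- **degree 1, `n = 4`**: `rank (θ ↦ θ ∧ v ∣ HT¹) = 8` for the two-exponential (`K`-secant) class `q_m = A λ^m + B μ^m`,
`λ ≠ μ`, `A, B ≠ 0`, on the wedge model `⋀(K^{Fin 4 ⊕ Fin 4})` of a fourfold — THEOREM T (`WedgePairGlue.transversePairLawAt`) at
`(n, k) = (4, 1)`; the CLASS-SIDE number behind (H3)'s `e₁^G ≥ 8`. -/
theorem secantRank_one_four {A B lam mu : K} (hlm : lam ≠ mu) (hA : A ≠ 0) (hB : B ≠ 0) :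
    finrank K (range (wedgeWith K 4 1 fun m => A * lam ^ m + B * mu ^ m)) = 8 :=
  (WedgePairGlue.transversePairLawAt K 4 (by norm_num) (k := 1) (by norm_num) A B lam mu hlm hA hB).trans (by decide)

/-- **degree 2, `n = 4`**: `rank (θ ↦ θ ∧ v ∣ HT²) = 12 = n(n−1)` for the same class — THEOREM T at `(n, k) = (4, 2)`; the
CLASS-SIDE number behind the pinch value `e₂^G = 12` ((H3)'s third entry; STRUCTURE C6 «the n = 4 ANCHOR-FREE identity
e₂^G = rank(⌟ch on (HT²)^G)»). -/
theorem secantRank_two_four {A B lam mu : K} (hlm : lam ≠ mu) (hA : A ≠ 0) (hB : B ≠ 0) :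
    finrank K (range (wedgeWith K 4 2 fun m => A * lam ^ m + B * mu ^ m)) = 12 :=
  (WedgePairGlue.transversePairLawAt K 4 (by norm_num) (k := 2) (by norm_num) A B lam mu hlm hA hB).trans (by decide)

end ClassSide

/-! ## §3. The COUNT BARRIER at `g = 8`: the Dolbeault target of `τ₂` on an abelian fourfold has dimension `28` -/

section CountBarrier
open Literature.AlgebraicGeometry.HodgeTheory Literature.AlgebraicGeometry.Motives
open Finset.HasAntidiagonal (antidiagonal mem_antidiagonal)

section Abstract
variable {K : Type*} [Field K] {E T : Type*} [AddCommGroup E] [Module K E] [AddCommGroup T] [Module K T]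

/-- rank–nullity: a linear map into a `t`-dimensional space has kernel of dimension `≥ dim E − t`
(stated additively, no truncated subtraction: `dim E ≤ dim ker τ + dim T`). -/
theorem finrank_le_finrank_ker_add [FiniteDimensional K E] [FiniteDimensional K T] (τ : E →ₗ[K] T) :
    finrank K E ≤ finrank K (ker τ) + finrank K T := by
  have h1 := LinearMap.finrank_range_add_finrank_ker τ
  have h2 : finrank K (range τ) ≤ finrank K T := Submodule.finrank_le _
  omega

/-- **COUNT BARRIER**: no linear map from a space of dimension `> dim T` into `T` is injective. -/
theorem not_injective_of_lt_finrank [FiniteDimensional K E] [FiniteDimensional K T] (τ : E →ₗ[K] T)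
    (h : finrank K T < finrank K E) : ¬ Injective τ := by
  intro hτ
  have := LinearMap.finrank_range_of_inj hτ
  have h2 : finrank K (range τ) ≤ finrank K T := Submodule.finrank_le _
  omega

end Abstract

variable (A : AbelianVariety ℂ) (B : HodgeModel A.dim A.X)

/-- `(0,2) ∈` the antidiagonal of `2`. -/
private lemma mem02 : ((0, 2) : ℕ × ℕ) ∈ antidiagonal 2 := mem_antidiagonal.2 rfl
/-- `(1,3) ∈` the antidiagonal of `4`. -/
private lemma mem13 : ((1, 3) : ℕ × ℕ) ∈ antidiagonal 4 := mem_antidiagonal.2 rfl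
/-- `(2,4) ∈` the antidiagonal of `6`. -/
private lemma mem24 : ((2, 4) : ℕ × ℕ) ∈ antidiagonal 6 := mem_antidiagonal.2 rfl

/-- **The Dolbeault target of the degree-2 semiregularity map on a complex abelian variety `A`, ON THE TREE'S CARRIER**:
the Hodge pieces `H^{0,2}(A) × H^{1,3}(A) × H^{2,4}(A)` of `H²`, `H⁴`, `H⁶(A(ℂ); ℂ)` read in a Hodge model `B`
(`HodgeModel.typePiece`; independent of `B` by `hodgePQ_independent_of_hodgeModel_holds`).  By the Dolbeault isomorphism
`H^{p,q}(A) ≅ H^q(A, Ω^p_A)` [Lange 2023, Thm 1.1.21 (a)] this is the printed target `⊕_{q=0}^{2} H^{q+2}(A, Ω^q_A)` of `τ₂`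
(for `dim A = 4` the summands `q ≥ 3` vanish). -/
abbrev DolbeaultTargetTwo : Type :=
  (B.typePiece 2 ⟨(0, 2), mem02⟩) × (B.typePiece 4 ⟨(1, 3), mem13⟩) × (B.typePiece 6 ⟨(2, 4), mem24⟩)

/-- `Hᵏ(A(ℂ); ℂ)` is finite-dimensional (tree: `H• = ⋀•H¹`). -/
private lemma finite_complexBetti (k : ℕ) : FiniteDimensional ℂ (complexBetti A.X k) :=
  abelianVarietyCohomologyExteriorH1.finite abelianVarietyCohomologyExteriorH1_holds A k

/-- the target is finite-dimensional (a theorem, not an instance: used via `haveI`). -/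
theorem finite_dolbeaultTargetTwo : FiniteDimensional ℂ (DolbeaultTargetTwo A B) := by
  haveI := finite_complexBetti A; infer_instance

/-- **`dim (H^{0,2} ⊕ H^{1,3} ⊕ H^{2,4})(A) = 6 + 16 + 6 = 28` for a complex abelian FOURFOLD** — from the tree's
`h^{p,q}(A) = C(g,p)·C(g,q)` (`HodgeModel.finrank_typePiece_eq_choose_mul_choose`, Lange Thm 1.1.21 (b) / van Geemen 3.3). -/
theorem finrank_dolbeaultTargetTwo (h4 : A.dim = 4) : finrank ℂ (DolbeaultTargetTwo A B) = 28 := by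
  haveI := finite_complexBetti A
  rw [Module.finrank_prod, Module.finrank_prod, B.finrank_typePiece_eq_choose_mul_choose A,
    B.finrank_typePiece_eq_choose_mul_choose A, B.finrank_typePiece_eq_choose_mul_choose A, h4]
  decide

variable {E : Type*} [AddCommGroup E] [Module ℂ E] [FiniteDimensional ℂ E]

/-- **COUNT BARRIER at `g = 8`, on the carrier**: for a complex abelian FOURFOLD `A`, any `ℂ`-linear map `τ` from a space `E`
(standing for `(Ext²)^G` of a `G`-equivariant object on `A` — not constructed) to the Dolbeault target
`H^{0,2} ⊕ H^{1,3} ⊕ H^{2,4}` has `dim ker τ ≥ dim E − 28`; in particular `dim E > 28 ⇒ τ` is not injective («NOT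
`G`-semiregular by COUNT alone»). -/
theorem finrank_le_finrank_ker_add_28 (h4 : A.dim = 4) (τ : E →ₗ[ℂ] DolbeaultTargetTwo A B) :
    finrank ℂ E ≤ finrank ℂ (ker τ) + 28 ∧ (28 < finrank ℂ E → ¬ Injective τ) := by
  haveI := finite_dolbeaultTargetTwo A B
  refine ⟨?_, fun h => not_injective_of_lt_finrank τ ?_⟩
  · simpa only [finrank_dolbeaultTargetTwo A B h4] using finrank_le_finrank_ker_add τ
  · simpa only [finrank_dolbeaultTargetTwo A B h4] using h

end CountBarrier

/-! ## §4. The Ext-window arithmetic on a fourfold, by value: LEMMA C (family B) and the (H1)/(H2)/(H3) laws of (S3) -/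

/-- The `Ext`-PROFILE of a (possibly `G`-equivariant) sheaf / object `F` on an abelian FOURFOLD, BY VALUE:
`e_k = dim Ext^k(F,F)` (or `dim Ext^k(F,F)^G`), `k = 0..4`, with SERRE DUALITY `e₃ = e₁`, `e₄ = e₀`.  Nothing is constructed. -/
structure FourfoldExtProfile where
  /-- `e_k = dim Ext^k(F,F)` (`^G`), `k = 0, …, 4`; `e₀ = 1` for `F` simple; `e₂` is the source of `τ₂` -/
  (e0 e1 e2 e3 e4 : ℕ)
  /-- Serre duality on the fourfold, degree 3 ↔ 1 -/
  serre3 : e3 = e1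
  /-- Serre duality on the fourfold, degree 4 ↔ 0 -/
  serre4 : e4 = e0

namespace FourfoldExtProfile
variable (d : FourfoldExtProfile)

/-- the Euler characteristic `χ = Σ_k (−1)^k e_k` (by HRR `= χ(F,F) = (ch F^∨ · ch F)_8`; by value here). -/
def chi : ℤ := (d.e0 : ℤ) - d.e1 + d.e2 - d.e3 + d.e4

/-- **LEMMA C** (census row B19-19, t-19 g5 / (B-XXII) B19-24: «on the abelian FOURFOLD E⁴: e₂ = χ − 2e₀ + 2e₁ by Serre
duality»; th-7 §D «χ^G = 2e₀^G − 2e₁^G + e₂^G»). -/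
theorem chi_eq : d.chi = 2 * (d.e0 : ℤ) - 2 * d.e1 + d.e2 := by
  simp only [chi, d.serre3, d.serre4]; ring

/-- **(B-XXII)'s count** (B19-24: «e₂(G_i) ≥ χ + 14 = 46 ∕ 110 > 28 on the simple fourfold factor»; B19-19 (g): «the 8
universal classes … so e₁ ≥ 8»): a SIMPLE `F` (`e₀ = 1`) with `e₁ ≥ 8` has `e₂ ≥ χ + 14`. -/
theorem chi_add_le_e2 (h0 : d.e0 = 1) (h1 : 8 ≤ d.e1) : d.chi + 14 ≤ d.e2 := by
  rw [d.chi_eq, h0]; push_cast; omega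

/-- **B19-19 (g), the simple-factor window**: if moreover `e₂ ≤ 28` (necessary for `τ₂` injective, §3) then `χ ≤ 30 − 2e₁ ≤ 14`
(census: «for SIMPLE factors 8d(d·rk² + β²) ≤ 30 − 2e₁ ≤ 14 ⇒ the x∣y-box door at n = 4 is CLOSED for K = ℚ(√−2), ℚ(√−3)»). -/
theorem chi_le_of_e2_le (h0 : d.e0 = 1) (h1 : 8 ≤ d.e1) (h28 : d.e2 ≤ 28) : d.chi ≤ 30 - 2 * d.e1 ∧ d.chi ≤ 14 := by
  rw [d.chi_eq, h0]; push_cast; omega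

/-- contrapositive: a simple `F` with `e₁ ≥ 8` and `χ(F,F) ≥ 15` has `e₂ > 28` — e.g. `χ = 32` (S2: `e₂ ≥ 46`), `χ = 96` (S5:
`e₂ ≥ 110`) — so by the COUNT BARRIER of §3 its `τ₂` cannot be injective. -/
theorem lt_e2_of_le_chi (h0 : d.e0 = 1) (h1 : 8 ≤ d.e1) (hchi : 15 ≤ d.chi) : 28 < d.e2 := by
  have := d.chi_add_le_e2 h0 h1; omega

end FourfoldExtProfile

section FamilyB
open Literature.AlgebraicGeometry.HodgeTheory Literature.AlgebraicGeometry.Motives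

/-- **LEMMA C + COUNT BARRIER on the carrier** (the skeleton of B19-19 (g) ∕ (B-XXII) at `g = 8`): for a complex abelian
FOURFOLD `A`, a space `E` of dimension `e₂` of a by-value profile with `e₀ = 1`, `e₁ ≥ 8`, `χ ≥ 15`, and ANY linear
`τ : E → H^{0,2} ⊕ H^{1,3} ⊕ H^{2,4}(A)`: `τ` is not injective (inputs by value: Serre, HRR's `χ`, simplicity, `e₁ ≥ 8`). -/
theorem not_injective_of_profile (A : AbelianVariety ℂ) (B : HodgeModel A.dim A.X) (h4 : A.dim = 4)
    (d : FourfoldExtProfile) (h0 : d.e0 = 1) (h1 : 8 ≤ d.e1) (hchi : 15 ≤ d.chi)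
    {E : Type*} [AddCommGroup E] [Module ℂ E] [FiniteDimensional ℂ E] (hE : finrank ℂ E = d.e2)
    (τ : E →ₗ[ℂ] DolbeaultTargetTwo A B) : ¬ Injective τ :=
  (finrank_le_finrank_ker_add_28 A B h4 τ).2 (by rw [hE]; exact d.lt_e2_of_le_chi h0 h1 hchi)

end FamilyB

/-- What a HYPOTHETICAL `G`-equivariant (`G ⊂` translations) secant-type object `F` on an abelian FOURFOLD would supply,
BY VALUE (th-7 FORMULA-N §D at `n = 4`): its `G`-invariant `Ext`-profile `e_k = dim Ext^k(F,F)^G` with Serre duality;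
`cardG = ∣G∣ ≥ 1`; `vv = (v,v)_χ ∈ ℤ`, the Mukai self-pairing of the `K`-secant class `v = ch(F)`; (H1) AT `n = 4`:
`0 < (v,v)_χ` (the sign `(−1)^{n/2}` is `+1`; HRR `(v,v)_χ = 2∣xc∣²(−4d)²∫_X b⁴/4!` GIVEN `∫_X b⁴ > 0` — argued from
polarisability, referee-read ref-4 13:46:16Z; a hypothesis of record); (H2)+HRR: `(v,v)_χ = χ(F,F) = ∣G∣·χ^G(F,F)` with
`χ^G = Σ_k (−1)^k e_k^G` (`G` acts freely by translations). -/
structure SecantDatumN4 extends FourfoldExtProfile where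
  /-- `∣G∣` -/
  cardG : ℕ
  /-- `G` is a (non-empty) group -/
  cardG_pos : 0 < cardG
  /-- the Mukai self-pairing `(v,v)_χ ∈ ℤ` of the `K`-secant class -/
  vv : ℤ
  /-- (H1) at `n = 4`: `(v,v)_χ > 0` (sign `(−1)^{4/2} = +1`, given `∫_X b⁴ > 0`) -/
  sign_law : 0 < vv
  /-- (H2) + HRR: `(v,v)_χ = ∣G∣ · χ^G(F,F)`, `χ^G = e₀ − e₁ + e₂ − e₃ + e₄` -/
  hrr : vv = cardG * ((e0 : ℤ) - e1 + e2 - e3 + e4)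

namespace SecantDatumN4
variable (d : SecantDatumN4)

/-- (H1) + (H2): `χ^G > 0` (a positive multiple of it is the positive number `(v,v)_χ`). -/
theorem chi_pos : 0 < d.chi := by
  have h := d.sign_law
  rw [d.hrr] at h
  exact pos_of_mul_pos_right (by simpa [FourfoldExtProfile.chi] using h) (by exact_mod_cast d.cardG_pos.le)

/-- **SHARP ARITHMETIC FORM**: the window `2e₀^G + e₂^G ≤ 2e₁^G` is already contradictory (it forces `χ^G ≤ 0`). -/
theorem false_of_le (h : 2 * d.e0 + d.e2 ≤ 2 * d.e1) : False := by
  have h1 := d.chi_pos; rw [d.chi_eq] at h1; omega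

/-- **NOGO-n4, the (S3) `n = 4` clause WITH (H3)** (STRUCTURE §2 l.178 verbatim: «(H3) for the n = 4 pinch e₀^G ≤ 2
(automatic for F simple), e₁^G ≥ 8, e₂^G = 12 — so «at n = 4 none is G-semiregular at all» holds exactly for objects satisfying
(H3)»): (H1) ∧ (H2) ∧ (H3) is contradictory — `χ^G = 2e₀ − 2e₁ + 12 ≤ 0 < χ^G`; the inequality IS the tree's
`Mod4Sign.pinch_n4_euler_nonpos` (s4-prove-3), used here verbatim (by-value `ℤ` form of `Mod4Sign.no_G_semiregular_secant_n4`). -/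
theorem false_of_H3 (h0 : d.e0 ≤ 2) (h1 : 8 ≤ d.e1) (h2 : d.e2 = 12) : False := by
  have hle := Mod4Sign.pinch_n4_euler_nonpos (e₀ := (d.e0 : ℤ)) (e₁ := (d.e1 : ℤ)) (by exact_mod_cast h0) (by exact_mod_cast h1)
  have hpos := d.chi_pos
  simp only [FourfoldExtProfile.chi, d.serre3, d.serre4, h2] at hpos
  push_cast at hpos
  omega

/-- Contrapositive: under (H1)/(H2), `e₀^G ≤ 2` and `e₁^G ≥ 8` force `e₂^G ≥ 13` — above the pinch value `12` that a
`G`-semiregular such object would have (§1); in particular `e₂^G ≤ 12` is already impossible. -/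
theorem thirteen_le_e2 (h0 : d.e0 ≤ 2) (h1 : 8 ≤ d.e1) : 13 ≤ d.e2 := by by_contra h; exact d.false_of_le (by omega)

/-- The LEMMA PROFILE `(e₀,…,e₄)^G = (1, 8, 12, 8, 1) = P_4` satisfies (H3); a datum with that profile is exactly what p10's
`ParityDatum 4` packages (`(v,v)_χ = ∣G∣·P_4(−1) = −2∣G∣`): the first clause of (S3) at `n = 4`
(`Uniform.parityDatum_false_of_four_dvd`) and the present clause AGREE on the Lemma profile. -/
noncomputable def toParityDatum (h : d.e0 = 1 ∧ d.e1 = 8 ∧ d.e2 = 12) : Uniform.ParityDatum 4 where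
  cardG := d.cardG
  cardG_pos := d.cardG_pos
  vv := d.vv
  sign_law := fun _ => by
    rw [show (4 : ℕ) / 2 = 2 from rfl]
    simpa using d.sign_law
  profile_law := by
    rw [Uniform.chiExtremal_of_even (by norm_num) (by decide), d.hrr, d.serre3, d.serre4, h.1, h.2.1, h.2.2]
    ring

/-- … and indeed no datum has the Lemma profile (either clause kills it). -/
theorem false_of_lemmaProfile (h : d.e0 = 1 ∧ d.e1 = 8 ∧ d.e2 = 12) : False :=
  Uniform.parityDatum_false_of_four_dvd (by norm_num) (dvd_refl 4) (d.toParityDatum h)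

end SecantDatumN4

/-- **(H3) IS LOAD-BEARING** (STRUCTURE l.178 «a non-simple G-invariant object with e₀^G ≥ 3 is outside the pinch»; VERDICT
§ g = 8 «STRUCTURAL-NO NOT CLAIMED»): the by-value laws (H1)/(H2) + Serre ARE satisfiable once `e₀^G = 3` — e.g.
`(e_k^G) = (3, 8, 12, 8, 3)`, `∣G∣ = 1`, `(v,v)_χ = χ^G = 2 > 0`.  So NOGO-n4 is a statement about objects inside the window,
not an all-object barrier at `g = 8`. -/
def outsidePinch : SecantDatumN4 where
  e0 := 3
  e1 := 8
  e2 := 12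
  e3 := 8
  e4 := 3
  serre3 := rfl
  serre4 := rfl
  cardG := 1
  cardG_pos := Nat.one_pos
  vv := 2
  sign_law := by norm_num
  hrr := by norm_num

/-! ## §5. NOGO-n4 composed: from the maps to «`τ₂` is not injective» -/

section Composed
variable {K : Type*} [Field K]
variable {HT1 HT2 E1 E2 T1 T2 : Type*}
  [AddCommGroup HT1] [Module K HT1] [AddCommGroup HT2] [Module K HT2]
  [AddCommGroup E1] [Module K E1] [AddCommGroup E2] [Module K E2]
  [AddCommGroup T1] [Module K T1] [AddCommGroup T2] [Module K T2]
  [FiniteDimensional K E1] [FiniteDimensional K E2]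

/-- **NOGO-n4 — «at `n = 4` no secant-type object is `G`-semiregular at all», composed from the maps** ((H3) DISCHARGED
down to simplicity): `E₁ = (Ext¹)^G`, `E₂ = (Ext²)^G` finite-dimensional; `ev_k : HT^k → E_k`, `τ_k : E_k → T_k` with BRIDGES
`τ_k ∘ ev_k = c_k` to class-side maps of ranks `8`, `12` (the fourfold `K`-secant numbers, §2); the (Σ5) DUALITY «`τ₂` injective
⇒ `ev₂` onto» (Serre, by value); `e₀ = dim Hom^G ≤ 2` (simple `F`); (H1)/(H2) by value: `0 < (v,v)_χ = ∣G∣·(2e₀ − 2 dim E₁ +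
dim E₂)`.  THEN `τ₂` IS NOT INJECTIVE.  Proof: `8 ≤ dim E₁` (`rank_le_finrank`); if `τ₂` were injective the pinch gives
`dim E₂ = 12` (`finrank_eq_of_pinch`), and `χ^G = 2e₀ − 2 dim E₁ + 12 ≤ 0 < χ^G`. -/
theorem not_injective_tau_two
    (ev₁ : HT1 →ₗ[K] E1) (τ₁ : E1 →ₗ[K] T1) (c₁ : HT1 →ₗ[K] T1) (bridge₁ : τ₁ ∘ₗ ev₁ = c₁)
    (hc₁ : finrank K (range c₁) = 8)
    (ev₂ : HT2 →ₗ[K] E2) (τ₂ : E2 →ₗ[K] T2) (c₂ : HT2 →ₗ[K] T2) (bridge₂ : τ₂ ∘ₗ ev₂ = c₂)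
    (hc₂ : finrank K (range c₂) = 12)
    (duality : Injective τ₂ → Surjective ev₂)
    (e0 cardG : ℕ) (hG : 0 < cardG) (vv : ℤ) (sign_law : 0 < vv)
    (hrr : vv = cardG * (2 * (e0 : ℤ) - 2 * (finrank K E1 : ℤ) + (finrank K E2 : ℤ)))
    (simple : e0 ≤ 2) :
    ¬ Injective τ₂ := by
  intro hτ
  have h1 : 8 ≤ finrank K E1 := rank_le_finrank ev₁ τ₁ c₁ bridge₁ hc₁
  have h2 : finrank K E2 = 12 := finrank_eq_of_pinch ev₂ τ₂ c₂ bridge₂ hc₂ (duality hτ) hτ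
  have hchi : 0 < 2 * (e0 : ℤ) - 2 * (finrank K E1 : ℤ) + (finrank K E2 : ℤ) := by
    rw [hrr] at sign_law
    exact pos_of_mul_pos_right sign_law (by exact_mod_cast hG.le)
  rw [h2] at hchi
  push_cast at hchi
  omega

/-- **NOGO-n4 on the wedge MODEL of the fourfold** (class side = the tree's THEOREM T, no rank hypothesis left): for maps
`ev_k`, `τ_k` whose composites ARE the wedge maps `θ ↦ θ ∧ v` on `⋀¹`, `⋀²` of `K^{Fin 4 ⊕ Fin 4}` for a two-exponential class
`q_m = A λ^m + B μ^m` (`λ ≠ μ`, `A, B ≠ 0`: a transversal `K`-secant class, th-7 Def. A.2, in the model), with the (Σ5) duality,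
simplicity and (H1)/(H2) by value as above: `τ₂` is not injective. -/
theorem not_injective_tau_two_model {A B lam mu : K} (hlm : lam ≠ mu) (hA : A ≠ 0) (hB : B ≠ 0)
    (ev₁ : (⋀[K]^1 (N K 4)) →ₗ[K] E1) (τ₁ : E1 →ₗ[K] HT K 4)
    (bridge₁ : τ₁ ∘ₗ ev₁ = wedgeWith K 4 1 fun m => A * lam ^ m + B * mu ^ m)
    (ev₂ : (⋀[K]^2 (N K 4)) →ₗ[K] E2) (τ₂ : E2 →ₗ[K] HT K 4)
    (bridge₂ : τ₂ ∘ₗ ev₂ = wedgeWith K 4 2 fun m => A * lam ^ m + B * mu ^ m)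
    (duality : Injective τ₂ → Surjective ev₂)
    (e0 cardG : ℕ) (hG : 0 < cardG) (vv : ℤ) (sign_law : 0 < vv)
    (hrr : vv = cardG * (2 * (e0 : ℤ) - 2 * (finrank K E1 : ℤ) + (finrank K E2 : ℤ)))
    (simple : e0 ≤ 2) :
    ¬ Injective τ₂ :=
  not_injective_tau_two ev₁ τ₁ _ bridge₁ (secantRank_one_four K hlm hA hB) ev₂ τ₂ _ bridge₂
    (secantRank_two_four K hlm hA hB) duality e0 cardG hG vv sign_law hrr simple

end Composed

end Summit.Ventures.HSemireg.FormulaN.PinchN4
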